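import Summits.QuantumFields.YangMills.Theorems.ColdStartUniversalityLatticeLangevinDossSussmannODE
import HarnessLib

/-!
# Route `ColdStartUniversality` (fixed-cut-off SZZ dynamics; conjugation calculus, file 9):
# THE DOSS–SUSSMANN RANDOM ODE IN VECTOR FORM — `V = BᴴU` solves `V̇ = F(t, V)` as a configuration-valued path

Helper file (seat `ym-line-csu-p1`, g23).  The coordinatewise derivative statements of `…DossSussmannODE` are assembled
into ONE vector-valued statement on the configuration space `Edge → (Fin N → Fin N → ℂ)` (elementwise norm):
* `hasDerivWithinAt_conjProduct_pair_vec` — a.s., for all `t ≥ 0`, the conjugated product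
  `u ↦ (e ↦ (ρU²_e(u⁺))ᴴ ρU¹_e(u⁺))` has right-derivative `e ↦ (ρU²_e)ᴴ (D₁ − D₂) ρU¹_e (t)` within `[0,∞)`;
* ★★ `hasDerivWithinAt_dossSussmann_vec` — with `B` the free Brownian motion (`β = 0`): `V = (ρB)ᴴ ρU` solves the RANDOM
  ODE `V̇(t) = F_ω(t, V(t))`, `F_ω(t, M)_e = (ρB_e(t))ᴴ · D_β(e' ↦ ρB_{e'}(t) M_{e'})_e · ρB_e(t) M_e` — the field depends on
  `ω` only through the continuous path `B(ω)`; this is the form in which ODE uniqueness / smooth dependence on the start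
  apply (successor files).
THEOREMS ONLY, no sorry.  HONEST FRAMING: fixed-cut-off calculus; nothing K-uniform; no crux, rung or summit statement is
proved; the Yang–Mills mass gap is NOT proved.
-/

set_option autoImplicit false

noncomputable section

namespace Summit.QuantumFields.YangMills.Theorems.ColdStartUniversality

open MeasureTheory ProbabilityTheory Finset Filter
open scoped NNReal Matrix ComplexConjugate Topology
open Literature.Probability.Process Literature.MathematicalPhysics.QuantumFieldTheory
open Literature.MathematicalPhysics.QuantumLattice (fundamentalRep fundamentalLatticeRep continuous_fundamentalRep
  fundamentalRep_mem_unitaryGroup)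

/-- A complex-valued function of a real variable is differentiable within a set if its real and imaginary parts are, with
the expected derivative. [folklore] -/
theorem hasDerivWithinAt_of_re_im {f : ℝ → ℂ} {a b : ℝ} {s : Set ℝ} {x : ℝ}
    (hre : HasDerivWithinAt (fun u => (f u).re) a s x) (him : HasDerivWithinAt (fun u => (f u).im) b s x) :
    HasDerivWithinAt f (⟨a, b⟩ : ℂ) s x := by
  have h := (hre.ofReal_comp).add (him.ofReal_comp.mul_const Complex.I)
  have hf : ((fun y => ((f y).re : ℂ)) + fun y => ((f y).im : ℂ) * Complex.I) = f :=
    funext fun u => by simp only [Pi.add_apply]; exact Complex.re_add_im (f u)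
  rw [hf] at h
  have hab : (⟨a, b⟩ : ℂ) = (a : ℂ) + (b : ℂ) * Complex.I := by apply Complex.ext <;> simp
  rw [hab]; exact h

/-- ★ **Vector form of the derivative of the conjugated product.**  For two regular SZZ solution families driven by the
same flat noise: almost surely, for all `t ≥ 0`, the configuration-valued path `u ↦ (e,k,l) ↦ ((ρU²_e(u⁺))ᴴ ρU¹_e(u⁺))_{kl}`
has right-derivative `(e,k,l) ↦ ((ρU²_e)ᴴ (D_{β true}(U¹) − D_{β false}(U²)) ρU¹_e)(t)_{kl}` at `t`. [folklore] -/
theorem hasDerivWithinAt_conjProduct_pair_vec (L : ℕ) [NeZero L] (β : Bool → ℝ) {Ω : Type} [MeasurableSpace Ω]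
    {P : Measure Ω} [IsProbabilityMeasure P] {W : ℝ≥0 → Ω → (Edge 3 L × NoiseIdx 2 → ℝ)} (hW : IsFlatBrownian W P)
    (U : Bool → GaugeConfig 3 L (Matrix.specialUnitaryGroup (Fin 2) ℂ) → ℝ≥0 → Ω →
      GaugeConfig 3 L (Matrix.specialUnitaryGroup (Fin 2) ℂ))
    (hU : ∀ s x, (∀ ω, U s x 0 ω = x) ∧
      (latticeLangevinDynamics (fundamentalLatticeRep 2) (β s)).IsSolution (fundamentalRep (Fin 2))
        hW.natFiltration P W (U s x))
    (hUm : ∀ (s : Bool) (i : ℝ≥0), Measurable[@Prod.instMeasurableSpace (Set.Iic i)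
        (GaugeConfig 3 L (Matrix.specialUnitaryGroup (Fin 2) ℂ) × Ω) inferInstance
        (@Prod.instMeasurableSpace (GaugeConfig 3 L (Matrix.specialUnitaryGroup (Fin 2) ℂ)) Ω inferInstance
          (hW.natFiltration i))]
      (fun q : Set.Iic i × (GaugeConfig 3 L (Matrix.specialUnitaryGroup (Fin 2) ℂ) × Ω) => U s q.2.1 q.1 q.2.2))
    (x : Bool → GaugeConfig 3 L (Matrix.specialUnitaryGroup (Fin 2) ℂ)) :
    ∀ᵐ ω ∂P, ∀ t : ℝ, 0 ≤ t →
      HasDerivWithinAt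
        (fun (u : ℝ) (e : Edge 3 L) (k l : Fin (fundamentalLatticeRep 2).N) =>
          (((fundamentalLatticeRep 2).ρ (U false (x false) u.toNNReal ω e))ᴴ *
            (fundamentalLatticeRep 2).ρ (U true (x true) u.toNNReal ω e)) k l)
        (fun (e : Edge 3 L) (k l : Fin (fundamentalLatticeRep 2).N) =>
          (((fundamentalLatticeRep 2).ρ (U false (x false) t.toNNReal ω e))ᴴ *
            ((fundamentalLatticeRep 2).driftLie (β true)
                (matrixConfig (fundamentalLatticeRep 2).ρ (U true (x true) t.toNNReal ω)) e -
              (fundamentalLatticeRep 2).driftLie (β false)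
                (matrixConfig (fundamentalLatticeRep 2).ρ (U false (x false) t.toNNReal ω)) e) *
            (fundamentalLatticeRep 2).ρ (U true (x true) t.toNNReal ω e)) k l)
        (Set.Ici 0) t := by
  have hall : ∀ᵐ ω ∂P, ∀ (e : Edge 3 L) (k l : Fin (fundamentalLatticeRep 2).N) (c : Bool), ∀ t : ℝ, 0 ≤ t →
      HasDerivWithinAt
        (fun u : ℝ => (fun z : ℂ => if c then z.im else z.re)
          ((((fundamentalLatticeRep 2).ρ (U false (x false) u.toNNReal ω e))ᴴ *
            (fundamentalLatticeRep 2).ρ (U true (x true) u.toNNReal ω e)) k l))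
        ((fun z : ℂ => if c then z.im else z.re)
          ((((fundamentalLatticeRep 2).ρ (U false (x false) t.toNNReal ω e))ᴴ *
            ((fundamentalLatticeRep 2).driftLie (β true)
                (matrixConfig (fundamentalLatticeRep 2).ρ (U true (x true) t.toNNReal ω)) e -
              (fundamentalLatticeRep 2).driftLie (β false)
                (matrixConfig (fundamentalLatticeRep 2).ρ (U false (x false) t.toNNReal ω)) e) *
            (fundamentalLatticeRep 2).ρ (U true (x true) t.toNNReal ω e)) k l))
        (Set.Ici 0) t :=
    ae_all_iff.2 fun e => ae_all_iff.2 fun k => ae_all_iff.2 fun l => ae_all_iff.2 fun c =>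
      hasDerivWithinAt_conjProduct_pair L β hW U hU hUm x e k l c
  filter_upwards [hall] with ω hω t ht
  refine hasDerivWithinAt_pi.2 fun e => hasDerivWithinAt_pi.2 fun k => hasDerivWithinAt_pi.2 fun l => ?_
  exact hasDerivWithinAt_of_re_im (hω e k l false t ht) (hω e k l true t ht)

/-- ★★ **The Doss–Sussmann random ODE in vector form.**  `B` a regular solution family of the FREE dynamics (`β = 0`),
`U` one at coupling `β`, same flat noise, starts `b, x`.  Then almost surely, for all `t ≥ 0`, the configuration-valued
path `V(u) = (e,k,l) ↦ ((ρB_e(u⁺))ᴴ ρU_e(u⁺))_{kl}` has right-derivative `F_ω(t, V(t))` within `[0, ∞)`, where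
`F_ω(t, M)_e = (ρB_e(t⁺))ᴴ · D_β(e' ↦ ρB_{e'}(t⁺) M_{e'})_e · (ρB_e(t⁺) M_e)` is a field depending on `ω` only
through the path `B(ω)`. [folklore] -/
theorem hasDerivWithinAt_dossSussmann_vec (L : ℕ) [NeZero L] (β : ℝ) {Ω : Type} [MeasurableSpace Ω]
    {P : Measure Ω} [IsProbabilityMeasure P] {W : ℝ≥0 → Ω → (Edge 3 L × NoiseIdx 2 → ℝ)} (hW : IsFlatBrownian W P)
    (B U : GaugeConfig 3 L (Matrix.specialUnitaryGroup (Fin 2) ℂ) → ℝ≥0 → Ω →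
      GaugeConfig 3 L (Matrix.specialUnitaryGroup (Fin 2) ℂ))
    (hB : ∀ x, (∀ ω, B x 0 ω = x) ∧
      (latticeLangevinDynamics (fundamentalLatticeRep 2) 0).IsSolution (fundamentalRep (Fin 2)) hW.natFiltration P W (B x))
    (hBm : ∀ i : ℝ≥0, Measurable[@Prod.instMeasurableSpace (Set.Iic i)
        (GaugeConfig 3 L (Matrix.specialUnitaryGroup (Fin 2) ℂ) × Ω) inferInstance
        (@Prod.instMeasurableSpace (GaugeConfig 3 L (Matrix.specialUnitaryGroup (Fin 2) ℂ)) Ω inferInstance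
          (hW.natFiltration i))]
      (fun q : Set.Iic i × (GaugeConfig 3 L (Matrix.specialUnitaryGroup (Fin 2) ℂ) × Ω) => B q.2.1 q.1 q.2.2))
    (hU : ∀ x, (∀ ω, U x 0 ω = x) ∧
      (latticeLangevinDynamics (fundamentalLatticeRep 2) β).IsSolution (fundamentalRep (Fin 2)) hW.natFiltration P W (U x))
    (hUm : ∀ i : ℝ≥0, Measurable[@Prod.instMeasurableSpace (Set.Iic i)
        (GaugeConfig 3 L (Matrix.specialUnitaryGroup (Fin 2) ℂ) × Ω) inferInstance
        (@Prod.instMeasurableSpace (GaugeConfig 3 L (Matrix.specialUnitaryGroup (Fin 2) ℂ)) Ω inferInstance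
          (hW.natFiltration i))]
      (fun q : Set.Iic i × (GaugeConfig 3 L (Matrix.specialUnitaryGroup (Fin 2) ℂ) × Ω) => U q.2.1 q.1 q.2.2))
    (b x : GaugeConfig 3 L (Matrix.specialUnitaryGroup (Fin 2) ℂ)) :
    ∀ᵐ ω ∂P, ∀ t : ℝ, 0 ≤ t →
      HasDerivWithinAt
        (fun (u : ℝ) (e : Edge 3 L) (k l : Fin (fundamentalLatticeRep 2).N) =>
          (((fundamentalLatticeRep 2).ρ (B b u.toNNReal ω e))ᴴ * (fundamentalLatticeRep 2).ρ (U x u.toNNReal ω e)) k l)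
        ((fun (s : ℝ) (M : Edge 3 L → Fin (fundamentalLatticeRep 2).N → Fin (fundamentalLatticeRep 2).N → ℂ)
            (e : Edge 3 L) (k l : Fin (fundamentalLatticeRep 2).N) =>
          (((fundamentalLatticeRep 2).ρ (B b s.toNNReal ω e))ᴴ *
            (fundamentalLatticeRep 2).driftLie β
              (fun e' => (fundamentalLatticeRep 2).ρ (B b s.toNNReal ω e') * Matrix.of (M e')) e *
            ((fundamentalLatticeRep 2).ρ (B b s.toNNReal ω e) * Matrix.of (M e))) k l)
          t (fun (e : Edge 3 L) (k l : Fin (fundamentalLatticeRep 2).N) =>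
            (((fundamentalLatticeRep 2).ρ (B b t.toNNReal ω e))ᴴ * (fundamentalLatticeRep 2).ρ (U x t.toNNReal ω e)) k l))
        (Set.Ici 0) t := by
  have h := hasDerivWithinAt_conjProduct_pair_vec L (fun s => cond s β 0) hW (fun s => cond s U B)
    (fun s => by cases s <;> simpa using (by first | exact hB | exact hU))
    (fun s => by cases s <;> simpa using (by first | exact hBm | exact hUm)) (fun s => cond s x b)
  have hρu : ∀ g : Matrix.specialUnitaryGroup (Fin 2) ℂ,
      (fundamentalLatticeRep 2).ρ g ∈ Matrix.unitaryGroup (Fin (fundamentalLatticeRep 2).N) ℂ :=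
    (fundamentalLatticeRep 2).mem_unitary
  filter_upwards [h] with ω hω t ht
  have h1 := hω t ht
  simp only [cond_true, cond_false, driftLie_zero, sub_zero] at h1
  -- `ρB_e (ρB_e)ᴴ ρU_e = ρU_e`: the field evaluated along `V = BᴴU` is the Doss–Sussmann derivative
  have hBB : ∀ e, (fundamentalLatticeRep 2).ρ (B b t.toNNReal ω e) *
      Matrix.of (fun k l : Fin (fundamentalLatticeRep 2).N =>
        (((fundamentalLatticeRep 2).ρ (B b t.toNNReal ω e))ᴴ * (fundamentalLatticeRep 2).ρ (U x t.toNNReal ω e)) k l) =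
      (fundamentalLatticeRep 2).ρ (U x t.toNNReal ω e) := by
    intro e
    have hu : (fundamentalLatticeRep 2).ρ (B b t.toNNReal ω e) * ((fundamentalLatticeRep 2).ρ (B b t.toNNReal ω e))ᴴ = 1 := by
      rw [← Matrix.star_eq_conjTranspose]; exact Matrix.mem_unitaryGroup_iff.1 (hρu _)
    have hof : Matrix.of (fun k l : Fin (fundamentalLatticeRep 2).N =>
        (((fundamentalLatticeRep 2).ρ (B b t.toNNReal ω e))ᴴ * (fundamentalLatticeRep 2).ρ (U x t.toNNReal ω e)) k l) =
        ((fundamentalLatticeRep 2).ρ (B b t.toNNReal ω e))ᴴ * (fundamentalLatticeRep 2).ρ (U x t.toNNReal ω e) := by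
      ext k l; rfl
    rw [hof, ← Matrix.mul_assoc, hu, Matrix.one_mul]
  have hcfg : (fun e' => (fundamentalLatticeRep 2).ρ (B b t.toNNReal ω e') *
      Matrix.of (fun k l : Fin (fundamentalLatticeRep 2).N =>
        (((fundamentalLatticeRep 2).ρ (B b t.toNNReal ω e'))ᴴ * (fundamentalLatticeRep 2).ρ (U x t.toNNReal ω e')) k l)) =
      matrixConfig (fundamentalLatticeRep 2).ρ (U x t.toNNReal ω) := by
    funext e'; rw [hBB e']; rfl
  refine h1.congr_deriv ?_
  funext e k l
  rw [hBB e, hcfg]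

end Summit.QuantumFields.YangMills.Theorems.ColdStartUniversality

end
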